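import Summits.QuantumAdvantage.QuantumAdvantage.Theorems.LinnikCubicClassGroupsDegreeOnePrimesEscapeDivisionThresholds
import Summits.QuantumAdvantage.QuantumAdvantage.Theorems.LinnikCubicClassGroupsDegreeOnePrimesEscapeDivisionTheta
import HarnessLib

/-!
# Thresholds and bookkeeping for the prime number theorem of a Frobenius division

Topic `Summits/QuantumAdvantage/QuantumAdvantage/Theorems`, cell B2b-1 (linnik-cubic), PART A (gen 10);
helper toward the crux `DegreeOnePrimesEscape` (stmt-QuantumAdvantage-11543) of route
`LinnikCubicClassGroups`.  HONEST FRAMING: the value of this file is a THEOREM (elementary bookkeeping) —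
NOT summit progress.

`…DivisionThresholds.lean` fixed the exponent `L(n)` of the EXISTENCE theorem for divisions, where all sizes
are compared at the single point `x = |d_N|^L`.  The two-sided prime number theorem for divisions (relative
error `ε`, every `x ≥ |d_N|^L`) needs the same comparisons with a factor `ε` and for all `x ≥ d^L`:

* `division_thresholds_eps` — for `n > 1`, `0 < c₁ ≤ 1`, `X, A ≥ 1`, `0 < ε ≤ 1`, `L₀` there is `L > 0` with
  `(1+n²)A ≤ L`, `L₀ ≤ L` and, for every `d ≥ 3` and every `x ≥ d^L` (`W = x c₁/(4 d^{2(1+n²)})`):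
  `X ≤ x`, `n x^{3/4} ≤ ε x/(4n²)`, `(n²+n) log d ≤ ε x/(4n²)`, `n x^{3/4} ≤ ε W/(4n²)`, `n² log d ≤ ε W/(4n²)`;
* `rpow_div_le_of_ge_window` — a real zero outside the window is harmless at every `x ≥ d^{L₀}`:
  `x^β/β ≤ η x` for `1/2 ≤ β ≤ 1 − c/(log d + log 4)`;
* `abs_sum_moebius_div_mul_sub_le` — two-sided termwise-to-sum for the Möbius combination;
* `degreeOneTheta_fixedField_le_theta_of_forall_mem`, `chebyshevTheta_eventually_le` — the two-sided
  prime number theorem input for the degree-one subfield `N^G = ℚ`.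
-/

noncomputable section

open scoped NumberField
open Finset Real
open Literature.NumberTheory.NumberFields Literature.NumberTheory.LFunctions
  Literature.NumberTheory.LFunctions.NumberField

namespace Summit.QuantumAdvantage.QuantumAdvantage.Theorems.DegreeOnePrimesEscape

/-! ### Thresholds with a relative-error factor `ε`, valid for all `x ≥ d^L` -/

set_option maxHeartbeats 800000 in
/-- **Thresholds for the division prime number theorem** (see the module docstring). -/
theorem division_thresholds_eps (n : ℕ) (hn : 1 < n) {c₁ X A ε : ℝ} (L₀ : ℝ) (hc₁ : 0 < c₁) (hc₁1 : c₁ ≤ 1)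
    (hX1 : 1 ≤ X) (hA1 : 1 ≤ A) (hε : 0 < ε) (hε1 : ε ≤ 1) :
    ∃ L : ℝ, 0 < L ∧ ((1 : ℝ) + n * n) * A ≤ L ∧ L₀ ≤ L ∧ ∀ d : ℝ, 3 ≤ d → ∀ x : ℝ, d ^ L ≤ x →
      X ≤ x ∧
      (n : ℝ) * x ^ (3 / 4 : ℝ) ≤ ε * x / (4 * n ^ 2) ∧
      ((n : ℝ) ^ 2 + n) * Real.log d ≤ ε * x / (4 * n ^ 2) ∧
      (n : ℝ) * x ^ (3 / 4 : ℝ) ≤ ε * (x * c₁ / (4 * d ^ (2 * ((1 : ℝ) + n * n)))) / (4 * n ^ 2) ∧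
      (n : ℝ) ^ 2 * Real.log d ≤ ε * (x * c₁ / (4 * d ^ (2 * ((1 : ℝ) + n * n)))) / (4 * n ^ 2) := by
  have hn1 : (1 : ℝ) ≤ n := by exact_mod_cast hn.le
  set e : ℝ := (1 : ℝ) + n * n with he
  have he1 : 1 ≤ e := by rw [he]; nlinarith
  have hε' : 1 ≤ 1 / ε := by rw [le_div_iff₀ hε]; linarith
  set X' : ℝ := max X ((4 * (n : ℝ) ^ 3 / ε) ^ 4) with hX'
  have hX'1 : 1 ≤ X' := le_trans hX1 (le_max_left _ _)
  set B₃ : ℝ := 4 * (n : ℝ) ^ 2 * ((n : ℝ) ^ 2 + n) / ε with hB₃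
  have hB₃1 : 1 ≤ B₃ := by
    rw [hB₃, le_div_iff₀ hε]; nlinarith [pow_le_pow_left₀ zero_le_one hn1 2]
  set B₅ : ℝ := (16 * (n : ℝ) ^ 3 / (c₁ * ε)) ^ 4 with hB₅
  have hcε : 0 < c₁ * ε := mul_pos hc₁ hε
  have hcε1 : c₁ * ε ≤ 1 := by nlinarith
  have hB₅1 : 1 ≤ B₅ := by
    rw [hB₅]; apply one_le_pow₀
    rw [le_div_iff₀ hcε]; nlinarith [pow_le_pow_left₀ zero_le_one hn1 3]
  set B₆ : ℝ := 16 * (n : ℝ) ^ 4 / (c₁ * ε) with hB₆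
  have hB₆1 : 1 ≤ B₆ := by rw [hB₆, le_div_iff₀ hcε]; nlinarith [pow_le_pow_left₀ zero_le_one hn1 4]
  set L : ℝ := max (max (e * A) L₀) (max (max (Real.logb 3 X') (1 + Real.logb 3 B₃))
    (max (8 * e + Real.logb 3 B₅) (2 * e + 1 + Real.logb 3 B₆))) with hL
  have hL1 : e * A ≤ L := le_trans (le_max_left _ _) (le_max_left _ _)
  have hL2 : L₀ ≤ L := le_trans (le_max_right _ _) (le_max_left _ _)
  have hL3 : Real.logb 3 X' ≤ L := le_trans (le_trans (le_max_left _ _) (le_max_left _ _)) (le_max_right _ _)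
  have hL4 : 1 + Real.logb 3 B₃ ≤ L :=
    le_trans (le_trans (le_max_right _ _) (le_max_left _ _)) (le_max_right _ _)
  have hL5 : 8 * e + Real.logb 3 B₅ ≤ L :=
    le_trans (le_trans (le_max_left _ _) (le_max_right _ _)) (le_max_right _ _)
  have hL6 : 2 * e + 1 + Real.logb 3 B₆ ≤ L :=
    le_trans (le_trans (le_max_right _ _) (le_max_right _ _)) (le_max_right _ _)
  have hLpos : 0 < L := lt_of_lt_of_le (by nlinarith) hL1
  refine ⟨L, hLpos, hL1, hL2, fun d hd3 x hx => ?_⟩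
  have hd0 : (0 : ℝ) < d := by linarith
  have hlogd : Real.log d ≤ d := (Real.log_le_sub_one_of_pos hd0).trans (by linarith)
  have hdL0 : 0 < d ^ L := Real.rpow_pos_of_pos hd0 L
  have hx0 : 0 < x := lt_of_lt_of_le hdL0 hx
  have hX'x : X' ≤ x := by
    have h := mul_rpow_le_rpow_of_logb hd3 hX'1 (show (0 : ℝ) + Real.logb 3 X' ≤ L by linarith)
    rw [Real.rpow_zero, mul_one] at h
    exact h.trans hx
  have hXx : X ≤ x := le_trans (le_max_left _ _) hX'x
  have hB₄x : (4 * (n : ℝ) ^ 3 / ε) ^ 4 ≤ x := le_trans (le_max_right _ _) hX'x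
  have hB₃x : B₃ * d ≤ x := by
    have h := mul_rpow_le_rpow_of_logb hd3 hB₃1 hL4; rw [Real.rpow_one] at h; exact h.trans hx
  have hB₅x : B₅ * d ^ (8 * e) ≤ x := (mul_rpow_le_rpow_of_logb hd3 hB₅1 hL5).trans hx
  have hB₆x : B₆ * d ^ (2 * e + 1) ≤ x := (mul_rpow_le_rpow_of_logb hd3 hB₆1 hL6).trans hx
  have hjunkA : (n : ℝ) * x ^ (3 / 4 : ℝ) ≤ ε * x / (4 * n ^ 2) := by
    have h := mul_rpow_three_quarters_le (B := 4 * (n : ℝ) ^ 3 / ε) (by positivity) hx0 hB₄x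
    rw [le_div_iff₀ (by positivity)]
    rw [div_mul_eq_mul_div, div_le_iff₀ hε] at h
    have e1 : (n : ℝ) * x ^ (3 / 4 : ℝ) * (4 * n ^ 2) = 4 * n ^ 3 * x ^ (3 / 4 : ℝ) := by ring
    rw [e1]; linarith
  have hlogj : ((n : ℝ) ^ 2 + n) * Real.log d ≤ ε * x / (4 * n ^ 2) := by
    have : ((n : ℝ) ^ 2 + n) * Real.log d ≤ ((n : ℝ) ^ 2 + n) * d :=
      mul_le_mul_of_nonneg_left hlogd (by positivity)
    rw [le_div_iff₀ (by positivity)]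
    have e3 : B₃ * d = 4 * n ^ 2 * (((n : ℝ) ^ 2 + n) * d) / ε := by rw [hB₃]; ring
    rw [e3, div_le_iff₀ hε] at hB₃x
    nlinarith
  set W : ℝ := x * c₁ / (4 * d ^ (2 * e)) with hWdef
  have hde0 : 0 < d ^ (2 * e) := by positivity
  have hj1 : (n : ℝ) * x ^ (3 / 4 : ℝ) ≤ ε * W / (4 * n ^ 2) := by
    have h8e : d ^ (8 * e) = (d ^ (2 * e)) ^ 4 := by
      rw [← Real.rpow_natCast, ← Real.rpow_mul hd0.le]; ring_nf
    have hB : (16 * (n : ℝ) ^ 3 * d ^ (2 * e) / (c₁ * ε)) ^ 4 ≤ x := by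
      calc (16 * (n : ℝ) ^ 3 * d ^ (2 * e) / (c₁ * ε)) ^ 4 = B₅ * d ^ (8 * e) := by
            rw [hB₅, h8e]; ring
        _ ≤ x := hB₅x
    have h := mul_rpow_three_quarters_le (B := 16 * (n : ℝ) ^ 3 * d ^ (2 * e) / (c₁ * ε)) (by positivity) hx0 hB
    rw [hWdef, le_div_iff₀ (by positivity)]
    rw [div_mul_eq_mul_div, div_le_iff₀ hcε] at h
    have e1 : (n : ℝ) * x ^ (3 / 4 : ℝ) * (4 * n ^ 2) = (16 * n ^ 3 * d ^ (2 * e) * x ^ (3 / 4 : ℝ)) /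
        (4 * d ^ (2 * e)) := by field_simp; ring
    have e2 : ε * (x * c₁ / (4 * d ^ (2 * e))) = (x * (c₁ * ε)) / (4 * d ^ (2 * e)) := by ring
    rw [e1, e2]
    exact div_le_div_of_nonneg_right h (by positivity)
  have hj2 : (n : ℝ) ^ 2 * Real.log d ≤ ε * W / (4 * n ^ 2) := by
    rw [hWdef, le_div_iff₀ (by positivity)]
    have e6 : B₆ * d ^ (2 * e + 1) = 16 * n ^ 4 * (d ^ (2 * e) * d) / (c₁ * ε) := by
      rw [hB₆, Real.rpow_add hd0, Real.rpow_one]; ring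
    have h5 : 16 * (n : ℝ) ^ 4 * (d ^ (2 * e) * d) ≤ x * (c₁ * ε) := by
      have := hB₆x; rw [e6, div_le_iff₀ hcε] at this; exact this
    have h6 : 16 * (n : ℝ) ^ 4 * d ^ (2 * e) * Real.log d ≤ 16 * n ^ 4 * d ^ (2 * e) * d :=
      mul_le_mul_of_nonneg_left hlogd (by positivity)
    have e7 : (n : ℝ) ^ 2 * Real.log d * (4 * n ^ 2) = (16 * n ^ 4 * d ^ (2 * e) * Real.log d) /
        (4 * d ^ (2 * e)) := by field_simp; ring
    have e2 : ε * (x * c₁ / (4 * d ^ (2 * e))) = (x * (c₁ * ε)) / (4 * d ^ (2 * e)) := by ring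
    rw [e7, e2]
    apply div_le_div_of_nonneg_right _ (by positivity)
    have e8 : 16 * (n : ℝ) ^ 4 * (d ^ (2 * e) * d) = 16 * n ^ 4 * d ^ (2 * e) * d := by ring
    linarith
  exact ⟨hXx, hjunkA, hlogj, hj1, hj2⟩

/-! ### A real zero outside the window, at every `x ≥ d^{L₀}` -/

/-- **A zero outside the window is harmless at every `x ≥ d^{L₀}`**: for `c, η > 0` there is `L₀ > 0` with
`x^β/β ≤ η x` whenever `d ≥ 3`, `d^{L₀} ≤ x`, `1/2 ≤ β ≤ 1 − c/(log d + log 4)`. -/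
theorem rpow_div_le_of_ge_window {c η : ℝ} (hc : 0 < c) (hη : 0 < η) :
    ∃ L₀ : ℝ, 0 < L₀ ∧ ∀ d : ℝ, 3 ≤ d → ∀ x : ℝ, d ^ L₀ ≤ x → ∀ β : ℝ, 1 / 2 ≤ β →
      β ≤ 1 - c / (Real.log d + Real.log 4) → x ^ β / β ≤ η * x := by
  obtain ⟨L₀, hL₀, h⟩ := rpow_div_le_of_le_window hc hη
  refine ⟨L₀, hL₀, fun d hd3 x hx β hβ hβc => ?_⟩
  have hd1 : (1 : ℝ) < d := by linarith
  have hd0 : (0 : ℝ) < d := by linarith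
  have hlogd : 0 < Real.log d := Real.log_pos hd1
  have hx0 : 0 < x := lt_of_lt_of_le (Real.rpow_pos_of_pos hd0 _) hx
  -- `x = d^{L'}` with `L' = log x / log d ≥ L₀`
  set L' : ℝ := Real.log x / Real.log d with hL'
  have hxL' : d ^ L' = x := by
    rw [Real.rpow_def_of_pos hd0, hL', mul_div_cancel₀ _ hlogd.ne', Real.exp_log hx0]
  have hL'ge : L₀ ≤ L' := by
    rw [hL', le_div_iff₀ hlogd]
    have h1 := Real.log_le_log (Real.rpow_pos_of_pos hd0 _) hx
    rwa [Real.log_rpow hd0] at h1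
  have := h d hd3 L' hL'ge β hβ hβc
  rwa [hxL'] at this

/-! ### Two-sided termwise-to-sum for the Möbius combination -/

/-- **Two-sided termwise to sum**: if `|T_d − Main_d| ≤ Err` for every `d ∣ m` (`Err ≥ 0`) then
`|Σ_{d ∣ m} (μ(d)/d) T_d − Σ_{d ∣ m} (μ(d)/d) Main_d| ≤ #(divisors m) · Err`. -/
theorem abs_sum_moebius_div_mul_sub_le (m : ℕ) (T Main : ℕ → ℝ) {Err : ℝ}
    (h : ∀ d ∈ m.divisors, |T d - Main d| ≤ Err) :
    |∑ d ∈ m.divisors, (ArithmeticFunction.moebius d : ℝ) / d * T d -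
        ∑ d ∈ m.divisors, (ArithmeticFunction.moebius d : ℝ) / d * Main d| ≤ m.divisors.card * Err := by
  rw [← Finset.sum_sub_distrib]
  calc |∑ d ∈ m.divisors, ((ArithmeticFunction.moebius d : ℝ) / d * T d -
          (ArithmeticFunction.moebius d : ℝ) / d * Main d)|
      ≤ ∑ d ∈ m.divisors, |(ArithmeticFunction.moebius d : ℝ) / d * T d -
          (ArithmeticFunction.moebius d : ℝ) / d * Main d| := Finset.abs_sum_le_sum_abs _ _
    _ ≤ ∑ _d ∈ m.divisors, Err := by
        refine Finset.sum_le_sum fun d hd => ?_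
        have hd1 : (1 : ℝ) ≤ d := by exact_mod_cast Nat.pos_of_mem_divisors hd
        have hμ : |(ArithmeticFunction.moebius d : ℝ)| ≤ 1 := by
          have := ArithmeticFunction.abs_moebius_le_one (n := d)
          exact_mod_cast this
        have hμd : |(ArithmeticFunction.moebius d : ℝ) / d| ≤ 1 := by
          rw [abs_div, abs_of_pos (by linarith : (0 : ℝ) < d), div_le_one (by linarith)]
          exact hμ.trans hd1
        rw [← mul_sub, abs_mul]
        have h0 : 0 ≤ |T d - Main d| := abs_nonneg _
        calc |(ArithmeticFunction.moebius d : ℝ) / d| * |T d - Main d| ≤ 1 * |T d - Main d| :=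
              mul_le_mul_of_nonneg_right hμd h0
          _ ≤ Err := by rw [one_mul]; exact h d hd
    _ = m.divisors.card * Err := by rw [Finset.sum_const, nsmul_eq_mul]

/-! ### The degree-one subfield: two-sided -/

section DegreeOne

variable {N : Type} [Field N] [NumberField N] [IsGalois ℚ N]

/-- **The subfield of degree one, upper bound**: if `H` is all of `Gal(N/ℚ)` then `N^H = ℚ` has at most one
prime of degree one above each `p`, so `θ¹_{N^H}(x) ≤ θ(x)`. -/
theorem degreeOneTheta_fixedField_le_theta_of_forall_mem (H : Subgroup (N ≃ₐ[ℚ] N)) (hH : ∀ g, g ∈ H)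
    (x : ℝ) : degreeOneTheta (IntermediateField.fixedField H) x ≤ Chebyshev.theta x := by
  classical
  have hHtop : H = ⊤ := (Subgroup.eq_top_iff' H).mpr hH
  have hfin : Module.finrank ℚ (IntermediateField.fixedField H) = 1 := by
    subst hHtop
    rw [IsGalois.fixedField_top]
    exact IntermediateField.finrank_bot
  rw [degreeOneTheta_eq_sum_count_one, Chebyshev.theta_eq_sum_primesLE]
  refine Finset.sum_le_sum fun p hp => ?_
  have hp' := (Nat.mem_primesLE.mp hp).2
  have hlog : 0 ≤ Real.log p := Real.log_natCast_nonneg p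
  have hc : (((splittingType (IntermediateField.fixedField H) p).count 1 : ℕ) : ℝ) ≤ 1 := by
    have := count_one_splittingType_le_finrank (K := IntermediateField.fixedField H) hp'
    rw [hfin] at this
    exact_mod_cast this
  calc (((splittingType (IntermediateField.fixedField H) p).count 1 : ℕ) : ℝ) * Real.log p
      ≤ 1 * Real.log p := mul_le_mul_of_nonneg_right hc hlog
    _ = Real.log p := one_mul _

end DegreeOne

/-- **`(1 − η) x ≤ θ(x) ≤ (1 + η) x` for `x ≥ x₀(η)`** (the prime number theorem for `ℚ`). [folklore] -/
theorem chebyshevTheta_eventually_abs {η : ℝ} (hη : 0 < η) :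
    ∃ x₀ : ℝ, 2 ≤ x₀ ∧ ∀ x : ℝ, x₀ ≤ x →
      (1 - η) * x ≤ Chebyshev.theta x ∧ Chebyshev.theta x ≤ (1 + η) * x := by
  obtain ⟨x₀, hx₀, h⟩ := degreeOneTheta_eventually ℚ hη
  refine ⟨x₀, hx₀, fun x hx => ?_⟩
  have hθ : degreeOneTheta ℚ x = Chebyshev.theta x := by
    rw [degreeOneTheta, Chebyshev.theta_eq_sum_primesLE]
    refine Finset.sum_congr rfl fun p _ => ?_
    rw [idealNormCount_rat, Nat.cast_one, one_mul]
  rw [← hθ]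
  exact h x hx

end Summit.QuantumAdvantage.QuantumAdvantage.Theorems.DegreeOnePrimesEscape

end
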